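import Mathlib
import Literature.NumberTheory.Sieve.Maynard2016Lemma7System
import Literature.NumberTheory.Sieve.Maynard2016Lemma7ClassCount
import HarnessLib

/-!
# Maynard (2016), Lemma 7: main term / error term split of the `q`-sum ((6.27) ⇒ (6.29) + (6.32))

Topic `Literature/NumberTheory/Sieve`; trunk AntSieve / parity (Maynard 2016 large-gaps ladder, named
fact `Literature.NumberTheory.Sieve.Maynard2016.Lemma7Tuple` of `Maynard2016Lemma7PerTuple.lean`).

J. Maynard, *Large gaps between primes*, Ann. of Math. (2) 183 (2016), 915–933 = arXiv:1408.5110,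
§6, proof of Lemma 7, p. 12: after expanding the square ((6.27), `sum_divSum_sub_sq_eq_sum_rbox`)
"there is no contribution unless [Div1–Div3] … In this case, the sum over `q` counts primes in
`[x/2, x]` in a single residue class modulo `r = r_{d,d',e,e'}` …  We write the number of primes
`q` counted in the inner sum as `#𝓘/φ(r) + O(E(x; r))`, where
`E(x; q) = sup_{(a,q)=1} |π(x; q, a) − π(x)/φ(q)|" ((6.28)–(6.29)), the main term being (6.32).

PROVED here (no named facts), for one index `i`, a prime `p₀ > x` with `(m p₀ − 1, P_y) = 1` and
`(m p₀ − 1, h_j − h_i) = 1` (`j ≠ i`), and the primes `𝓘 = intervalPrimes A B`, `1 ≤ A ≤ B ≤ X`, with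
`h_i q < p₀` on `𝓘`:
* `radMod d d' e e'` — the modulus `r`: the radical of `∏_j [d_j,d'_j] [e_j,e'_j]`
  (`radMod_pos`, `one_le_radMod`);
* `SysSolvable` — the system (6.27) (as the linear system of `Maynard2016Lemma7System`) has a
  solution `q ∈ ℕ` (this is the condition "Div1–Div3 and the compatibility of the congruences");
  `mainCoeff … N = N/φ(r)` if solvable, `0` otherwise;
* `abs_card_filter_system_sub_mainCoeff_le` — **per tuple**:
  `|#{q ∈ 𝓘 : (6.27)} − mainCoeff(#𝓘)| ≤ 2 E*(X; r)` with the tree's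
  `E*(X; r) = primeCountingAPErrMax X r` (`Maynard2016Lemma7ClassCount`);
* `abs_sum_divSum_sq_sub_main_le` — **summed with the weights**:
  `|Σ_{q ∈ 𝓘} (Σ_{d,e} λ_{d,e})²|_{n = p₀ − h_i q} − Σ_{d,d',e,e' ∈ rbox} λ_{d,e} λ_{d',e'} mainCoeff(#𝓘)|
   ≤ Σ_{d,d',e,e' ∈ rbox} |λ_{d,e} λ_{d',e'}| · 2 E*(X; r_{d,d',e,e'})`
  (the hypotheses of the per-tuple statement being discharged on the support of `λλ'` by
  `support_hyps_of_lam_ne_zero`);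
* `eventually_isCoprime_hTuple_sub` — the remaining hypothesis `(m p₀ − 1, h_j − h_i) = 1`, `j ≠ i`,
  holds for all large `x` whenever `(m p₀ − 1, P_y) = 1` (`P_w ∣ P_y` and every prime factor of
  `h_j − h_i` divides `P_w`, `Maynard2016TupleArith`).

What remains for (6.29)–(6.32) downstream: the error sum is `≪ λ_max² Σ_{r < x^{1/5+o(1)}} τ_{O(k)}(r)
E*(x; r)` (`Maynard2016Lemma7Regroup` + `Maynard2016Lemma7BV`), and the main term
`Σ λλ' mainCoeff` is evaluated as in Proposition 1 of the source ((6.32)).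

## References

* J. Maynard, *Large gaps between primes*, Ann. of Math. (2) 183 (2016), 915–933; arXiv:1408.5110,
  §6, proof of Lemma 7, displays (6.27)–(6.29), (6.32). [Maynard2016LargeGaps]
-/

noncomputable section

open Finset Filter
open scoped BigOperators

namespace Literature.NumberTheory.Sieve

namespace Maynard2016

variable {k : ℕ}

/-! ### The modulus `r` and the main coefficient -/

/-- `r = r_{d,d',e,e'}`: the radical of `∏_j [d_j,d'_j] [e_j,e'_j]` (the modulus of the single residue
class of `q`). [cite: Maynard2016LargeGaps, Lemma 7 (proof, display (6.28))] -/
def radMod (d d' e e' : Fin k → ℕ) : ℕ := ∏ p ∈ (∏ t, sysD d d' e e' t).primeFactors, p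

/-- `r > 0`. [cite: Maynard2016LargeGaps, Lemma 7 (proof, display (6.28))] -/
theorem radMod_pos (d d' e e' : Fin k → ℕ) : 0 < radMod d d' e e' :=
  Finset.prod_pos fun _ hp => (Nat.prime_of_mem_primeFactors hp).pos

/-- `r ≥ 1`. [cite: Maynard2016LargeGaps, Lemma 7 (proof, display (6.28))] -/
theorem one_le_radMod (d d' e e' : Fin k → ℕ) : 1 ≤ radMod d d' e e' := radMod_pos d d' e e'

/-- Solvability of the system (6.27) in `q ∈ ℕ` (in the linear form of `Maynard2016Lemma7System`):
"there is no contribution unless …" (Div1–Div3 of the source and the compatibility of the classes).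
[cite: Maynard2016LargeGaps, Lemma 7 (proof, p. 12)] -/
def SysSolvable (k x m p₀ : ℕ) (i : Fin k) (d d' e e' : Fin k → ℕ) : Prop :=
  ∃ q : ℕ, ∀ t ∈ (Finset.univ : Finset (Fin k ⊕ Fin k)),
    (sysD d d' e e' t : ℤ) ∣ sysP k m p₀ t + sysA k x i m t * q

open Classical in
/-- The main coefficient of a tuple: `N/φ(r)` if the system is solvable, `0` otherwise
((6.29) with `N = #𝓘`). [cite: Maynard2016LargeGaps, Lemma 7 (proof, display (6.29))] -/
def mainCoeff (k x m p₀ : ℕ) (i : Fin k) (d d' e e' : Fin k → ℕ) (N : ℝ) : ℝ :=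
  if SysSolvable k x m p₀ i d d' e e' then N / (Nat.totient (radMod d d' e e') : ℝ) else 0

/-- `|mainCoeff N| ≤ |N|` (`φ(r) ≥ 1`). [cite: Maynard2016LargeGaps, Lemma 7 (proof, display (6.29))] -/
theorem abs_mainCoeff_le (k x m p₀ : ℕ) (i : Fin k) (d d' e e' : Fin k → ℕ) (N : ℝ) :
    |mainCoeff k x m p₀ i d d' e e' N| ≤ |N| := by
  classical
  unfold mainCoeff
  split_ifs with h
  · have hφ : (1 : ℝ) ≤ Nat.totient (radMod d d' e e') := by
      exact_mod_cast Nat.totient_pos.2 (radMod_pos d d' e e')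
    rw [abs_div, Nat.abs_cast]
    exact div_le_self (abs_nonneg N) hφ
  · simp

/-! ### Per tuple: one class or nothing, counted with the error `E*` -/

/-- **Per-tuple count ((6.28)–(6.29)).**  Under the hypotheses of
`filter_system_eq_empty_or_class` and for `𝓘 = intervalPrimes A B` (`1 ≤ A ≤ B ≤ X`) on which
`h_i q < p₀`: `|#{q ∈ 𝓘 : (6.27)} − mainCoeff(#𝓘)| ≤ 2 E*(X; r)`. [cite: Maynard2016LargeGaps, Lemma 7 (proof, displays (6.28)–(6.29))] -/
theorem abs_card_filter_system_sub_mainCoeff_le {x m p₀ : ℕ} (hp₀ : p₀.Prime) (hm : 1 ≤ m)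
    {i : Fin k} {d d' e e' : Fin k → ℕ} (hd : ∀ j, Squarefree (d j))
    (hd' : ∀ j, Squarefree (d' j)) (he : ∀ j, Squarefree (e j)) (he' : ∀ j, Squarefree (e' j))
    (hdlt : ∀ j, d j * d' j < p₀) (hecop : ∀ j, Nat.Coprime (m * p₀ - 1) (e j * e' j))
    (hei : e i = 1) (hei' : e' i = 1)
    (hacop : ∀ j, j ≠ i → IsCoprime ((m : ℤ) * p₀ - 1) ((hTuple k x j : ℤ) - hTuple k x i))
    {A B : ℝ} {X : ℕ} (hA : 1 ≤ A) (hAB : A ≤ B) (hBX : B ≤ X)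
    (hQ : ∀ q ∈ intervalPrimes A B, hTuple k x i * q < p₀) :
    |((((intervalPrimes A B).filter (fun q => ∀ j ∈ (Finset.univ : Finset (Fin k)),
          Nat.lcm (d j) (d' j) ∣ p₀ - hTuple k x i * q + hTuple k x j * q ∧
            Nat.lcm (e j) (e' j) ∣ m * (p₀ - hTuple k x i * q + hTuple k x j * q) - 1)).card : ℕ) : ℝ) -
        mainCoeff k x m p₀ i d d' e e' ((intervalPrimes A B).card : ℝ)| ≤
      2 * primeCountingAPErrMax X (radMod d d' e e') := by
  classical
  have hd0 : ∀ j, d j ≠ 0 := fun j => (hd j).ne_zero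
  have hd0' : ∀ j, d' j ≠ 0 := fun j => (hd' j).ne_zero
  rcases linearSystem_empty_or_coprime_class (Finset.univ : Finset (Fin k ⊕ Fin k))
      (sysD d d' e e') (sysP k m p₀) (sysA k x i m) (sys_squarefree hd hd' he he')
      (sys_unit hp₀ hd0 hd0' hdlt hei hei' hacop) (sys_constant_coprime hp₀ hm hd0 hd0' hdlt hecop)
    with hnone | ⟨c, hc, hcop', hiff⟩
  · -- no solution at all: the count and the main coefficient both vanish
    have hsol : ¬ SysSolvable k x m p₀ i d d' e e' := fun ⟨q, hq⟩ => hnone q hq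
    have hfil : (intervalPrimes A B).filter (fun q => ∀ j ∈ (Finset.univ : Finset (Fin k)),
        Nat.lcm (d j) (d' j) ∣ p₀ - hTuple k x i * q + hTuple k x j * q ∧
          Nat.lcm (e j) (e' j) ∣ m * (p₀ - hTuple k x i * q + hTuple k x j * q) - 1) = ∅ := by
      refine Finset.filter_eq_empty_iff.2 fun q hq h => ?_
      exact hnone q ((system_iff_linearSystem hm d d' e e' (hQ q hq)).1 h)
    rw [hfil, mainCoeff, if_neg hsol]
    simpa using primeCountingAPErrMax_nonneg X (radMod d d' e e')
  · -- one class `c (mod r)` with `(c, r) = 1`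
    have hsol : SysSolvable k x m p₀ i d d' e e' := ⟨c, (hiff c).2 (Nat.mod_eq_of_lt hc)⟩
    have hfil : (intervalPrimes A B).filter (fun q => ∀ j ∈ (Finset.univ : Finset (Fin k)),
        Nat.lcm (d j) (d' j) ∣ p₀ - hTuple k x i * q + hTuple k x j * q ∧
          Nat.lcm (e j) (e' j) ∣ m * (p₀ - hTuple k x i * q + hTuple k x j * q) - 1) =
        (intervalPrimes A B).filter (fun q => q % radMod d d' e e' = c % radMod d d' e e') := by
      refine Finset.filter_congr fun q hq => ?_
      rw [system_iff_linearSystem hm d d' e e' (hQ q hq), hiff q, radMod, Nat.mod_eq_of_lt hc]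
    rw [hfil, mainCoeff, if_pos hsol]
    exact abs_card_intervalPrimes_filter_sub_le hA hAB hBX (one_le_radMod d d' e e') hcop'

/-! ### Summed over the tuples with the weights `λλ'` -/

/-- **Main/error split of the restricted `q`-sum ((6.27)–(6.29)).**
`|Σ_{q ∈ 𝓘} (Σ_{d,e} λ_{d,e})²|_{n = p₀ − h_i q} − Σ_{d,d',e,e' ∈ rbox} λλ' · mainCoeff(#𝓘)|
 ≤ Σ_{d,d',e,e' ∈ rbox} |λλ'| · 2 E*(X; r_{d,d',e,e'})`, for `p₀ > x` prime, `(m p₀ − 1, P_y) = 1`,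
`m ≥ 1`, `(m p₀ − 1, h_j − h_i) = 1` (`j ≠ i`), `𝓘 = intervalPrimes A B`, `1 ≤ A ≤ B ≤ X`,
`h_i q < p₀` on `𝓘`. [cite: Maynard2016LargeGaps, Lemma 7 (proof, displays (6.27)–(6.29))] -/
theorem abs_sum_divSum_sq_sub_main_le {J : ℕ} {c : Fin J → ℝ} {Fd : Fin k → Fin J → ℝ → ℝ}
    {G : ℝ → ℝ} (hD : IsSieveData k J c Fd G) {ε : ℝ} {x : ℕ} (hx1 : 1 ≤ x)
    (hlogx : 0 < Real.log x) (hlogy : 0 < Real.log (y ε x)) (hyx : y ε x ≤ x) {m p₀ : ℕ}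
    (hm : 1 ≤ m) (hp₀ : p₀.Prime) (hxp : x < p₀)
    (hcop : Nat.Coprime (m * p₀ - 1) (primorial ⌊y ε x⌋₊)) {i : Fin k}
    (hacop : ∀ j, j ≠ i → IsCoprime ((m : ℤ) * p₀ - 1) ((hTuple k x j : ℤ) - hTuple k x i))
    {A B : ℝ} {X : ℕ} (hA : 1 ≤ A) (hAB : A ≤ B) (hBX : B ≤ X)
    (hQ : ∀ q ∈ intervalPrimes A B, hTuple k x i * q < p₀) :
    |∑ q ∈ intervalPrimes A B, divSum c Fd G ε x m q (p₀ - hTuple k x i * q) ^ 2 -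
        ∑ d ∈ rbox k x i, ∑ d' ∈ rbox k x i, ∑ e ∈ rbox k x i, ∑ e' ∈ rbox k x i,
          lam c Fd G ε x d e * lam c Fd G ε x d' e' *
            mainCoeff k x m p₀ i d d' e e' ((intervalPrimes A B).card : ℝ)| ≤
      ∑ d ∈ rbox k x i, ∑ d' ∈ rbox k x i, ∑ e ∈ rbox k x i, ∑ e' ∈ rbox k x i,
        |lam c Fd G ε x d e * lam c Fd G ε x d' e'| *
          (2 * primeCountingAPErrMax X (radMod d d' e e')) := by
  classical
  have hB0 : (0 : ℝ) ≤ B := by linarith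
  have hQ' : ∀ q ∈ intervalPrimes A B, 0 < q ∧ hTuple k x i * q < p₀ := fun q hq =>
    ⟨((mem_intervalPrimes hB0).1 hq).1.pos, hQ q hq⟩
  rw [sum_divSum_sub_sq_eq_sum_rbox hD hx1 hlogx hlogy hyx hm hp₀ hxp hcop (intervalPrimes A B) hQ']
  simp only [← Finset.sum_sub_distrib, ← mul_sub]
  refine (Finset.abs_sum_le_sum_abs _ _).trans (Finset.sum_le_sum fun d hd => ?_)
  refine (Finset.abs_sum_le_sum_abs _ _).trans (Finset.sum_le_sum fun d' hd' => ?_)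
  refine (Finset.abs_sum_le_sum_abs _ _).trans (Finset.sum_le_sum fun e he => ?_)
  refine (Finset.abs_sum_le_sum_abs _ _).trans (Finset.sum_le_sum fun e' he' => ?_)
  rw [abs_mul]
  by_cases hl : lam c Fd G ε x d e = 0
  · simp [hl]
  by_cases hl' : lam c Fd G ε x d' e' = 0
  · simp [hl']
  refine mul_le_mul_of_nonneg_left ?_ (abs_nonneg _)
  obtain ⟨hdb, -⟩ := mem_rbox.1 hd
  obtain ⟨hdb', -⟩ := mem_rbox.1 hd'
  obtain ⟨heb, hei⟩ := mem_rbox.1 he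
  obtain ⟨heb', hei'⟩ := mem_rbox.1 he'
  obtain ⟨hsd, hsd', hse, hse', hdlt, hecop⟩ :=
    support_hyps_of_lam_ne_zero hD hx1 hlogx hlogy hxp hcop hdb hdb' heb heb' hl hl'
  exact abs_card_filter_system_sub_mainCoeff_le hp₀ hm hsd hsd' hse hse' hdlt hecop hei hei' hacop
    hA hAB hBX hQ

/-! ### The hypothesis `(m p₀ − 1, h_j − h_i) = 1` for large `x` -/

/-- **For all large `x`**: if `(m p₀ − 1, P_y) = 1` then `(m p₀ − 1, h_j − h_i) = 1` for `j ≠ i`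
(`P_w ∣ P_y` and every prime factor of `h_j − h_i` divides `P_w`). [cite: Maynard2016LargeGaps, Lemma 7 (proof, «q lies in a single residue class»)] -/
theorem eventually_isCoprime_hTuple_sub (k : ℕ) {ε : ℝ} (hε : ε ≤ 1 / 2) :
    ∀ᶠ x : ℕ in atTop, ∀ m p₀ : ℕ, 1 ≤ m * p₀ →
      Nat.Coprime (m * p₀ - 1) (primorial ⌊y ε x⌋₊) →
        ∀ i j : Fin k, j ≠ i → IsCoprime ((m : ℤ) * p₀ - 1) ((hTuple k x j : ℤ) - hTuple k x i) := by
  filter_upwards [eventually_coprime_hTuple_sub k, eventually_floor_wFun_le_floor_y hε] with x hx hwy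
    m p₀ hm1 hcop i j hji
  have hPw : Nat.Coprime (m * p₀ - 1) (Pw x) :=
    hcop.coprime_dvd_right (primorial_dvd_primorial hwy)
  have h := hx i j (Ne.symm hji) _ hPw
  rw [Int.isCoprime_iff_gcd_eq_one, Int.gcd_eq_natAbs]
  have hcast : ((m : ℤ) * p₀ - 1) = ((m * p₀ - 1 : ℕ) : ℤ) := by push_cast [Nat.cast_sub hm1]; ring
  rw [hcast, Int.natAbs_natCast]
  exact h

end Maynard2016

end Literature.NumberTheory.Sieve

end
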